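import Mathlib
import HarnessLib
import Literature.Analysis.FluidPDE.SelfSimilar
import Literature.Analysis.FluidPDE.LocalTypeI
import Literature.Analysis.FluidPDE.VectorCalculus
import Literature.Analysis.FluidPDE.VorticityCalculus
import Literature.Analysis.FluidPDE.KNSSRegularity
import Literature.Analysis.FluidPDE.KNSSRegularityProofs
import Literature.Analysis.FluidPDE.KNSSRegularityPlanar
import Literature.Analysis.FluidPDE.KNSSPlanarVorticity
import Literature.Analysis.FluidPDE.KNSSLiouvillePlanarHolds
import Literature.Analysis.FluidPDE.KNSSThm52Integrand
import Literature.Analysis.FluidPDE.AxisymNoSwirlVorticity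
import Literature.Analysis.FluidPDE.AxisymQuotientRayAverage
import Literature.Analysis.FluidPDE.SteadyLiouvilleTsaiVorticity
import Literature.Analysis.FluidPDE.KNSSThm52Assembly

/-!
# Route `PoloidalWindowDoor` (crux `PoloidalWindowRigidity`) and route `LocalVelCompTubeDoor` (S10, crux
# `VelCompWindowRigidity`) — ERTEL COLLAPSE, part 1 (KNSS p. 9 on `ℝ³` for the scalar `(curl U)₂` of the §4
# representative: Lemma 2.1 + the planar flux bound on horizontal discs)

Cell ns-regularity-ideate, seat p6 (route-directed support). For a profile `v` of the routes' Type-I class (rate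
`‖v(t,x)‖ ≤ C/√(−t)`, continuous on the open slab, unit-viscosity Oseen-mild, divergence-free slices) the third
component of the vorticity, `q = ω₃ = (curl v)₂`, solves `qₜ + v·∇q − Δq = (ω·∇)v₃ = ⟪Dv ω, e₃⟫` (vorticity equation,
third component). If the right-hand side vanishes identically — the FROZEN CONSTRAINT of the poloidal stratum
(`…FirstIntegral.stub_firstIntegral` is the converse), in particular if `v₃ ≡ 0` (S10's stub `stub_ertelCollapse`) —
then `q` is a KNSS scalar: after the time shift `t ↦ t − δ` the profile is a bounded ancient mild, hence bounded weak,
solution (`IsBoundedAncientMildSolution.isBoundedWeakNSSolutionOn`); KNSS §4 (`KNSS2009_regularity_boundedWeak_ancient`,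
PROVED in the tree) provides the regular representative `U + b(t)` with uniform `Cᵏ` bounds and the time-integrated
vorticity equation; Lemma 2.1 in half-ball form (`KNSS2009_lemma21_halfball_holds`, generic over the space, here `ℝ³`)
produces, if `sup q > 0`, parabolic balls of every radius on which `q ≥ sup q / 2`; but on the horizontal disc through
the centre of such a ball `q` is the planar curl of the bounded planar field `(U₀,U₁)(·,·,x₃)`, which the flux bound
`KNSSPlanarVorticity.false_of_curl2_ge_on_balls` (KNSS Thm 5.1, step (3)) forbids. Hence `q ≡ 0`:

* `planar_section_curl_apply_two` — the horizontal section of `(curl V)₂` is `curl2` of the planar field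
  `(V₀,V₁)(·,·,c)` (chain rule), bounded by `sup ‖V‖`;
* `nonpos_of_lemma21_of_planarFlux` — KNSS p. 9 on `ℝ³` for scalars whose super-level balls export planar
  `curl2`-balls (port of `KNSSLiouvillePlanar.curl2_nonpos_of_lemma21`);
* `curl_apply_two_eq_zero_of_lemma21` — for the §4 representative `U`: if the third component of the stretching
  `DU[ω]` vanishes for a.e. `t < 0`, then `(curl U)₂ ≡ 0` (port of `KNSSLiouvillePlanar.curl2_eq_zero_of_lemma21`);
(The class-level collapse `⟪Dv ω, e₃⟫ ≡ 0 ⇒ ω₃ ≡ 0` for Type-I profiles — time shift, mild ⇒ weak, a.e. slice ⇒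
every slice — is the companion file `…ErtelCollapse`.)

WHAT THIS IS NOT: not a claim about Navier–Stokes regularity and not the open residue of K2 — a Liouville-type lemma
for ONE vorticity component under the frozen constraint, for STAGED/DRAFT door routes of LADDER-NS N0.
-/

noncomputable section

-- the summit and its single sub-problem share the name (CONVENTIONS §1), as in every Theorems file
set_option linter.dupNamespace false

namespace Summit.NavierStokesRegularity.NavierStokesRegularity.Theorems.PoloidalWindowDoorPoloidalWindowRigidityErtelCollapseKNSS

open MeasureTheory Set Function Filter Topology TopologicalSpace Metric WithLp InnerProductSpace
open scoped RealInnerProductSpace InnerProductSpace Laplacian ContDiff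
open Literature.Analysis Literature.Analysis.FluidPDE

/-! ### the horizontal section of `(curl V)₂` is a planar `curl2` -/

/-- **Planar sections.** For `V ∈ C¹(ℝ³, ℝ³)` with `‖V‖ ≤ K` and a height `c`, the planar field
`w(y) = (V₀, V₁)(y₀, y₁, c)` is `C¹`, bounded by `K`, and `curl2 w (y) = (curl V)(y₀, y₁, c)₂`. -/
theorem planar_section_curl_apply_two {V : EuclideanSpace ℝ (Fin 3) → EuclideanSpace ℝ (Fin 3)} (hV : ContDiff ℝ 1 V)
    {K : ℝ} (hK : ∀ x, ‖V x‖ ≤ K) (c : ℝ) :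
    ∃ w : EuclideanSpace ℝ (Fin 2) → EuclideanSpace ℝ (Fin 2), ContDiff ℝ 1 w ∧ (∀ y, ‖w y‖ ≤ K) ∧
      ∀ y : EuclideanSpace ℝ (Fin 2), curl2 w y = curl V (toLp 2 ![y 0, y 1, c]) 2 := by
  -- the affine embedding `ι y = L y + c e₃` and the projection `Π`
  set L : EuclideanSpace ℝ (Fin 2) →L[ℝ] EuclideanSpace ℝ (Fin 3) :=
    (EuclideanSpace.proj (0 : Fin 2)).smulRight (EuclideanSpace.single (0 : Fin 3) (1 : ℝ)) +
      (EuclideanSpace.proj (1 : Fin 2)).smulRight (EuclideanSpace.single (1 : Fin 3) (1 : ℝ)) with hL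
  set P : EuclideanSpace ℝ (Fin 3) →L[ℝ] EuclideanSpace ℝ (Fin 2) :=
    (EuclideanSpace.proj (0 : Fin 3)).smulRight (EuclideanSpace.single (0 : Fin 2) (1 : ℝ)) +
      (EuclideanSpace.proj (1 : Fin 3)).smulRight (EuclideanSpace.single (1 : Fin 2) (1 : ℝ)) with hP
  have hι : ∀ y : EuclideanSpace ℝ (Fin 2),
      (toLp 2 ![y 0, y 1, c] : EuclideanSpace ℝ (Fin 3)) = L y + EuclideanSpace.single 2 c := by
    intro y
    ext i
    fin_cases i <;> simp [hL]
  have hL0 : L (EuclideanSpace.single 0 1) = EuclideanSpace.single 0 1 := by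
    ext i; fin_cases i <;> simp [hL]
  have hL1 : L (EuclideanSpace.single 1 1) = EuclideanSpace.single 1 1 := by
    ext i; fin_cases i <;> simp [hL]
  have hP0 : ∀ z : EuclideanSpace ℝ (Fin 3), P z 0 = z 0 := fun z => by simp [hP]
  have hP1 : ∀ z : EuclideanSpace ℝ (Fin 3), P z 1 = z 1 := fun z => by simp [hP]
  set ι : EuclideanSpace ℝ (Fin 2) → EuclideanSpace ℝ (Fin 3) := fun y => L y + EuclideanSpace.single 2 c with hιdef
  have hιd : ∀ y, HasFDerivAt ι L y := fun y => (L.hasFDerivAt).add_const _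
  refine ⟨fun y => P (V (ι y)), ?_, fun y => ?_, fun y => ?_⟩
  · -- `C¹`
    exact P.contDiff.comp (hV.comp (L.contDiff.add contDiff_const))
  · -- the bound: `‖(a, b)‖ ≤ ‖(a, b, c')‖`
    have h2 : ‖P (V (ι y))‖ ^ 2 ≤ ‖V (ι y)‖ ^ 2 := by
      rw [EuclideanSpace.norm_sq_eq, EuclideanSpace.norm_sq_eq, Fin.sum_univ_two, Fin.sum_univ_three, hP0, hP1]
      simp only [Real.norm_eq_abs, sq_abs]
      nlinarith [sq_nonneg (V (ι y) 2)]
    have h3 : ‖P (V (ι y))‖ ≤ ‖V (ι y)‖ := by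
      nlinarith [norm_nonneg (P (V (ι y))), norm_nonneg (V (ι y)), h2]
    exact h3.trans (hK _)
  · -- `curl2 w = (curl V)₂ ∘ ι`
    have hVd : DifferentiableAt ℝ V (ι y) := (hV.differentiable one_ne_zero) _
    have hw : HasFDerivAt (fun y => P (V (ι y))) (P.comp ((fderiv ℝ V (ι y)).comp L)) y :=
      P.hasFDerivAt.comp y (hVd.hasFDerivAt.comp y (hιd y))
    rw [curl2, hw.fderiv, hι y, curl_apply_two]
    simp only [ContinuousLinearMap.comp_apply, hL0, hL1, hP0, hP1, hιdef]

/-- Points of the horizontal disc of radius `R` through the centre `y₁` of a ball `B(y₁, R) ⊂ ℝ³` lie in the ball. -/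
theorem section_mem_ball {y₁ : EuclideanSpace ℝ (Fin 3)} {R : ℝ} {y : EuclideanSpace ℝ (Fin 2)}
    (hy : y ∈ ball (toLp 2 ![y₁ 0, y₁ 1] : EuclideanSpace ℝ (Fin 2)) R) :
    (toLp 2 ![y 0, y 1, y₁ 2] : EuclideanSpace ℝ (Fin 3)) ∈ ball y₁ R := by
  rw [mem_ball, EuclideanSpace.dist_eq] at hy ⊢
  rw [Fin.sum_univ_three]
  rw [Fin.sum_univ_two] at hy
  simpa using hy

/-! ### KNSS p. 9 on `ℝ³` for scalars with planar flux structure -/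

/-- **A KNSS scalar whose super-level balls export planar `curl2`-balls is nonpositive** (KNSS 2009, proof of
Thm 5.1, p. 9, run on `ℝ³`). Let `f : ℝ → ℝ³ → ℝ` satisfy the hypotheses of `KNSS2009_lemma21_halfball` on
`ℝ³ × (−∞,0)` (bounded; `C²` slices; bounded, jointly continuous `Df`, `Δf`; the time-integrated drift–diffusion
equation with a bounded measurable drift), and suppose that whenever `f(t,·) ≥ m` on a ball `B(y₁, R)` there is a
planar `C¹` field `w` with `‖w‖ ≤ K` and `curl2 w ≥ m` on a planar disc of radius `R`. Then `f ≤ 0`. -/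
theorem nonpos_of_lemma21_of_planarFlux (h21 : KNSS2009_lemma21_halfball (EuclideanSpace ℝ (Fin 3)))
    {f : ℝ → EuclideanSpace ℝ (Fin 3) → ℝ} {a : ℝ → EuclideanSpace ℝ (Fin 3) → EuclideanSpace ℝ (Fin 3)} {A K : ℝ}
    (ha : Measurable (uncurry a)) (haA : ∀ t < 0, ∀ y, ‖a t y‖ ≤ A)
    (hfb : ∃ C : ℝ, ∀ t < 0, ∀ y, |f t y| ≤ C) (hf2 : ∀ t < 0, ContDiff ℝ 2 (f t))
    (hfD : ∃ C : ℝ, ∀ t < 0, ∀ y, ‖fderiv ℝ (f t) y‖ ≤ C ∧ |(Δ (f t)) y| ≤ C)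
    (hcD : ContinuousOn (fun p : ℝ × EuclideanSpace ℝ (Fin 3) => fderiv ℝ (f p.1) p.2) (Iio 0 ×ˢ univ))
    (hcΔ : ContinuousOn (fun p : ℝ × EuclideanSpace ℝ (Fin 3) => (Δ (f p.1)) p.2) (Iio 0 ×ˢ univ))
    (heq : ∀ y, ∀ s t : ℝ, s ≤ t → t < 0 →
      f t y - f s y = ∫ τ in s..t, ((Δ (f τ)) y - fderiv ℝ (f τ) y (a τ y)))
    (hrep : ∀ t < 0, ∀ (y₁ : EuclideanSpace ℝ (Fin 3)) (R m : ℝ), (∀ y ∈ ball y₁ R, m ≤ f t y) →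
      ∃ (w : EuclideanSpace ℝ (Fin 2) → EuclideanSpace ℝ (Fin 2)) (z : EuclideanSpace ℝ (Fin 2)),
        ContDiff ℝ 1 w ∧ (∀ x, ‖w x‖ ≤ K) ∧ ∀ x ∈ ball z R, m ≤ curl2 w x) :
    ∀ t < 0, ∀ y, f t y ≤ 0 := by
  by_contra hcon
  push Not at hcon
  obtain ⟨t₀, ht₀, y₀, hy₀⟩ := hcon
  obtain ⟨C, hC⟩ := hfb
  -- the set of values of `f` on the slab, its supremum `M₁`
  set S : Set ℝ := (fun p : ℝ × EuclideanSpace ℝ (Fin 3) => f p.1 p.2) '' (Iio (0 : ℝ) ×ˢ (univ : Set (EuclideanSpace ℝ (Fin 3)))) with hS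
  have hbdd : BddAbove S := by
    refine ⟨C, ?_⟩
    rintro r ⟨⟨t, y⟩, ⟨ht, -⟩, rfl⟩
    exact (le_abs_self _).trans (hC t ht y)
  have hmem : ∀ t < 0, ∀ y, f t y ∈ S := fun t ht y => ⟨(t, y), ⟨ht, mem_univ _⟩, rfl⟩
  have hne : S.Nonempty := ⟨_, hmem t₀ ht₀ y₀⟩
  set M₁ : ℝ := sSup S with hM₁
  have hle : ∀ t < 0, ∀ y, f t y ≤ M₁ := fun t ht y => le_csSup hbdd (hmem t ht y)
  have hpos : 0 < M₁ := hy₀.trans_le (hle t₀ ht₀ y₀)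
  have happ : ∀ ε > 0, ∃ t < 0, ∃ y, M₁ - ε < f t y := by
    intro ε hε
    obtain ⟨r, ⟨⟨t, y⟩, ⟨ht, -⟩, rfl⟩, hr⟩ :=
      exists_lt_of_lt_csSup hne (by linarith : M₁ - ε < sSup S)
    exact ⟨t, ht, y, hr⟩
  -- Lemma 2.1: half-balls of every radius
  have H := h21 ha haA ⟨C, hC⟩ hf2 hfD hcD hcΔ heq hle happ hpos
  -- the planar flux bound forbids them
  refine false_of_curl2_ge_on_balls (K := K) (half_pos hpos) fun R hR => ?_
  obtain ⟨y₁, t₁, ht₁, hball⟩ := H R hR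
  have ht₂ : t₁ - R ^ 2 / 2 ∈ Ioo (t₁ - R ^ 2) t₁ := by
    constructor <;> nlinarith [sq_nonneg R, hR]
  have ht₂' : t₁ - R ^ 2 / 2 < 0 := by nlinarith [sq_nonneg R]
  obtain ⟨w, z, hw, hwK, hwm⟩ := hrep _ ht₂' y₁ R (M₁ / 2) fun y hy => hball _ ht₂ y hy
  exact ⟨w, z, hw, hwK, hwm⟩

/-! ### the third vorticity component of the §4 representative vanishes under the frozen constraint -/

/-- **`(curl U)₂ ≡ 0` for the §4 representative under the frozen constraint** (KNSS p. 9 for the scalar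
`q = (curl U)₂`). Let `U : ℝ → ℝ³ → ℝ³`, `b : ℝ → ℝ³` carry the clauses of `KNSS2009_regularity_boundedWeak_ancient`
(smooth slices with uniformly bounded derivatives, derivatives of order `≥ 1` Lipschitz in time, `U` jointly
measurable, `b` bounded measurable, the time-integrated vorticity equation with drift `U + b`), and assume the third
component of the stretching `DU(τ)[ω(τ)]` vanishes for a.e. `τ < 0`. Then `(curl U(t))₂ ≡ 0` for every `t < 0`:
`q` is in the class of Lemma 2.1 with the source-free equation, its horizontal sections are planar curls of the
bounded fields `(U₀,U₁)(·,·,x₃)` (`planar_section_curl_apply_two`), so `nonpos_of_lemma21_of_planarFlux` applied to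
`q` and to `−q` (field `−U`, same drift) gives `q ≡ 0`. -/
theorem curl_apply_two_eq_zero_of_lemma21 (h21 : KNSS2009_lemma21_halfball (EuclideanSpace ℝ (Fin 3)))
    {U : ℝ → EuclideanSpace ℝ (Fin 3) → EuclideanSpace ℝ (Fin 3)} {b : ℝ → EuclideanSpace ℝ (Fin 3)}
    (hbm : Measurable b) (hbC : ∃ C : ℝ, ∀ t, ‖b t‖ ≤ C) (hUm : Measurable (uncurry U))
    (hsmooth : ∀ t < 0, ContDiff ℝ ∞ (U t))
    (hbd : ∀ k : ℕ, ∃ C : ℝ, ∀ t < 0, ∀ x, ‖iteratedFDeriv ℝ k (U t) x‖ ≤ C)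
    (hlip : ∀ k : ℕ, 1 ≤ k → ∃ L : ℝ, ∀ s < 0, ∀ t < 0, ∀ x,
      ‖iteratedFDeriv ℝ k (U t) x - iteratedFDeriv ℝ k (U s) x‖ ≤ L * |t - s|)
    (hvort : ∀ x, ∀ s t : ℝ, s ≤ t → t < 0 →
      curl (U t) x - curl (U s) x =
        ∫ τ in s..t, ((Δ (curl (U τ))) x - fderiv ℝ (curl (U τ)) x (U τ x + b τ) +
          fderiv ℝ (U τ) x (curl (U τ) x)))
    (hstr : ∀ᵐ τ ∂(volume.restrict (Iio (0 : ℝ))), ∀ x, fderiv ℝ (U τ) x (curl (U τ) x) 2 = 0) :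
    ∀ t < 0, ∀ x, curl (U t) x 2 = 0 := by
  -- notation and constants
  set ζ : ℝ → EuclideanSpace ℝ (Fin 3) → ℝ := fun t y => curl (U t) y 2 with hζ
  set a : ℝ → EuclideanSpace ℝ (Fin 3) → EuclideanSpace ℝ (Fin 3) := fun t y => U t y + b t with ha
  set Kc : ℝ := ‖(curlCLM : (EuclideanSpace ℝ (Fin 3) →L[ℝ] EuclideanSpace ℝ (Fin 3)) →L[ℝ]
    EuclideanSpace ℝ (Fin 3))‖ with hKc
  have hKc0 : 0 ≤ Kc := by rw [hKc]; positivity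
  obtain ⟨Cb, hCb⟩ := hbC
  obtain ⟨C₀, hC₀⟩ := hbd 0
  obtain ⟨C₁, hC₁⟩ := hbd 1
  obtain ⟨C₂, hC₂⟩ := hbd 2
  obtain ⟨C₃, hC₃⟩ := hbd 3
  obtain ⟨L₁, hL₁⟩ := hlip 1 le_rfl
  obtain ⟨L₂, hL₂⟩ := hlip 2 (by norm_num)
  obtain ⟨L₃, hL₃⟩ := hlip 3 (by norm_num)
  have hU1 : ∀ t < 0, ContDiff ℝ 1 (U t) := fun t ht => contDiff_infty.1 (hsmooth t ht) 1
  have hU2 : ∀ t < 0, ContDiff ℝ 2 (U t) := fun t ht => contDiff_infty.1 (hsmooth t ht) 2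
  have hU3 : ∀ t < 0, ContDiff ℝ 3 (U t) := fun t ht => contDiff_infty.1 (hsmooth t ht) 3
  have hU4 : ∀ t < 0, ContDiff ℝ 4 (U t) := fun t ht => contDiff_infty.1 (hsmooth t ht) 4
  have hc1 : ∀ t < 0, ContDiff ℝ 1 (curl (U t)) := fun t ht => contDiff_curl (n := 1) (hU2 t ht)
  have hc2 : ∀ t < 0, ContDiff ℝ 2 (curl (U t)) := fun t ht => contDiff_curl (n := 2) (hU3 t ht)
  have hcd : ∀ t < 0, Differentiable ℝ (curl (U t)) := fun t ht => (hc1 t ht).differentiable one_ne_zero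
  have hproj : ∀ t, ζ t = (EuclideanSpace.proj (2 : Fin 3) : EuclideanSpace ℝ (Fin 3) →L[ℝ] ℝ) ∘ curl (U t) :=
    fun t => rfl
  -- the drift
  have ham : Measurable (uncurry a) := by
    have : uncurry a = fun p : ℝ × EuclideanSpace ℝ (Fin 3) => uncurry U p + b p.1 := by
      funext p; rfl
    rw [this]
    exact hUm.add (hbm.comp measurable_fst)
  have haA : ∀ t < 0, ∀ y, ‖a t y‖ ≤ C₀ + Cb := fun t ht y => by
    have h0 := hC₀ t ht y
    rw [norm_iteratedFDeriv_zero] at h0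
    exact (norm_add_le _ _).trans (add_le_add h0 (hCb t))
  -- the slices of `ζ` are `C²`
  have hζ2 : ∀ t < 0, ContDiff ℝ 2 (ζ t) := fun t ht => by
    rw [hproj t]
    exact (EuclideanSpace.proj (2 : Fin 3)).contDiff.comp (hc2 t ht)
  -- bounds
  have hζb : ∀ t < 0, ∀ y, |ζ t y| ≤ Kc * C₁ := fun t ht y => by
    have h := norm_iteratedFDeriv_curl_apply_two_le (n := 0) (hU1 t ht) y
    rw [norm_iteratedFDeriv_zero, Real.norm_eq_abs] at h
    exact h.trans (mul_le_mul_of_nonneg_left (hC₁ t ht y) hKc0)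
  have hζD : ∀ t < 0, ∀ y, ‖fderiv ℝ (ζ t) y‖ ≤ Kc * C₂ := fun t ht y => by
    have h := norm_iteratedFDeriv_curl_apply_two_le (n := 1) (hU2 t ht) y
    rw [norm_iteratedFDeriv_one] at h
    exact h.trans (mul_le_mul_of_nonneg_left (hC₂ t ht y) hKc0)
  have hζΔ : ∀ t < 0, ∀ y, |(Δ (ζ t)) y| ≤ 3 * (Kc * C₃) := fun t ht y => by
    have h := norm_iteratedFDeriv_curl_apply_two_le (n := 2) (hU3 t ht) y
    have h3 := norm_laplacian_le_three_mul (ζ t) y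
    rw [Real.norm_eq_abs] at h3
    exact h3.trans (mul_le_mul_of_nonneg_left (h.trans (mul_le_mul_of_nonneg_left (hC₃ t ht y) hKc0))
      (by norm_num))
  have hfD : ∃ C : ℝ, ∀ t < 0, ∀ y, ‖fderiv ℝ (ζ t) y‖ ≤ C ∧ |(Δ (ζ t)) y| ≤ C :=
    ⟨max (Kc * C₂) (3 * (Kc * C₃)), fun t ht y =>
      ⟨(hζD t ht y).trans (le_max_left _ _), (hζΔ t ht y).trans (le_max_right _ _)⟩⟩
  -- `ζ t − ζ s` is the third vorticity component of `U t − U s`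
  have hζsub : ∀ s < 0, ∀ t < 0, (ζ t - ζ s) = fun y => curl (U t - U s) y 2 := by
    intro s hs t ht
    funext y
    rw [← curl_sub_slice hU1 hs ht]
    rfl
  -- time-Lipschitz bounds for `Dζ` and `Δζ`
  have hDlip : ∀ s < 0, ∀ t < 0, ∀ y,
      ‖fderiv ℝ (ζ t) y - fderiv ℝ (ζ s) y‖ ≤ Kc * (L₂ * |t - s|) := by
    intro s hs t ht y
    have hW : ContDiff ℝ 2 (U t - U s) := (hU2 t ht).sub (hU2 s hs)
    have h := norm_iteratedFDeriv_curl_apply_two_le (n := 1) hW y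
    rw [norm_iteratedFDeriv_one] at h
    rw [← fderiv_sub ((hζ2 t ht).differentiable two_ne_zero y) ((hζ2 s hs).differentiable two_ne_zero y),
      hζsub s hs t ht]
    exact h.trans (mul_le_mul_of_nonneg_left (norm_iteratedFDeriv_sub_slice_le hU2 hL₂ hs ht y) hKc0)
  have hΔlip : ∀ s < 0, ∀ t < 0, ∀ y,
      |(Δ (ζ t)) y - (Δ (ζ s)) y| ≤ 3 * (Kc * (L₃ * |t - s|)) := by
    intro s hs t ht y
    have hW : ContDiff ℝ 3 (U t - U s) := (hU3 t ht).sub (hU3 s hs)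
    have h := norm_iteratedFDeriv_curl_apply_two_le (n := 2) hW y
    rw [← (hζ2 t ht).contDiffAt.laplacian_sub (hζ2 s hs).contDiffAt, hζsub s hs t ht]
    have h3 := norm_laplacian_le_three_mul (fun y => curl (U t - U s) y 2) y
    rw [Real.norm_eq_abs] at h3
    exact h3.trans (mul_le_mul_of_nonneg_left
      (h.trans (mul_le_mul_of_nonneg_left (norm_iteratedFDeriv_sub_slice_le hU3 hL₃ hs ht y) hKc0)) (by norm_num))
  -- joint continuity of `Dζ` and `Δζ` on the slab
  have hcD : ContinuousOn (fun p : ℝ × EuclideanSpace ℝ (Fin 3) => fderiv ℝ (ζ p.1) p.2) (Iio 0 ×ˢ univ) := by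
    refine continuousOn_prod_of_continuousOn_lipschitzOnWith _ (Real.toNNReal (Kc * L₂))
      (fun t ht => ?_) (fun y _ => ?_)
    · exact ((hζ2 t ht).continuous_fderiv two_ne_zero).continuousOn
    · refine LipschitzOnWith.of_dist_le' fun t ht s hs => ?_
      rw [dist_eq_norm, Real.dist_eq]
      simpa [mul_assoc] using hDlip s hs t ht y
  have hcΔ : ContinuousOn (fun p : ℝ × EuclideanSpace ℝ (Fin 3) => (Δ (ζ p.1)) p.2) (Iio 0 ×ˢ univ) := by
    refine continuousOn_prod_of_continuousOn_lipschitzOnWith _ (Real.toNNReal (3 * (Kc * L₃)))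
      (fun t ht => ?_) (fun y _ => ?_)
    · exact (continuous_laplacian (hζ2 t ht)).continuousOn
    · refine LipschitzOnWith.of_dist_le' fun t ht s hs => ?_
      rw [Real.dist_eq, Real.dist_eq]
      simpa [mul_assoc] using hΔlip s hs t ht y
  -- the time-integrated equation for `ζ`: third component of the vorticity equation, stretching term a.e. zero
  have heq : ∀ y, ∀ s t : ℝ, s ≤ t → t < 0 →
      ζ t y - ζ s y = ∫ τ in s..t, ((Δ (ζ τ)) y - fderiv ℝ (ζ τ) y (a τ y)) := by
    intro y s t hst ht
    have hint := intervalIntegrable_vorticity_integrand hU4 hUm hbm ⟨Cb, hCb⟩ hbd hlip y hst ht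
    have hv := hvort y s t hst ht
    -- apply the third coordinate projection to the vector identity
    set π : EuclideanSpace ℝ (Fin 3) →L[ℝ] ℝ := EuclideanSpace.proj (2 : Fin 3) with hπ
    have hπap : ∀ z : EuclideanSpace ℝ (Fin 3), π z = z 2 := fun z => rfl
    have h1 : ζ t y - ζ s y = π (curl (U t) y - curl (U s) y) := by
      rw [map_sub, hπap, hπap]
    rw [h1, hv, ← π.intervalIntegral_comp_comm hint]
    refine intervalIntegral.integral_congr_ae ?_
    have hstr' : ∀ᵐ τ ∂(volume : Measure ℝ), τ ∈ Iio (0 : ℝ) → ∀ x, fderiv ℝ (U τ) x (curl (U τ) x) 2 = 0 :=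
      (ae_restrict_iff' measurableSet_Iio).1 hstr
    filter_upwards [hstr'] with τ hτ hτI
    have hτ0 : τ < 0 := by
      rw [Set.uIoc_of_le hst] at hτI
      exact lt_of_le_of_lt hτI.2 ht
    have hs0 := hτ hτ0 y
    rw [map_add, map_sub, hπap, hπap, hπap, hs0, add_zero,
      Tsai2021.laplacian_apply_coord (hc2 τ hτ0) y 2, Tsai2021.fderiv_apply_coord (hcd τ hτ0) y (a τ y) 2]
  -- planar flux structure of `ζ` and of `−ζ`
  have hrep : ∀ (ε : ℝ), (ε = 1 ∨ ε = -1) → ∀ t < 0, ∀ (y₁ : EuclideanSpace ℝ (Fin 3)) (R m : ℝ),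
      (∀ y ∈ ball y₁ R, m ≤ ε * ζ t y) →
      ∃ (w : EuclideanSpace ℝ (Fin 2) → EuclideanSpace ℝ (Fin 2)) (z : EuclideanSpace ℝ (Fin 2)),
        ContDiff ℝ 1 w ∧ (∀ x, ‖w x‖ ≤ C₀) ∧ ∀ x ∈ ball z R, m ≤ curl2 w x := by
    intro ε hε t ht y₁ R m hm
    have hV : ContDiff ℝ 1 (fun y => ε • U t y) := (hU1 t ht).const_smul ε
    have hVK : ∀ x, ‖ε • U t x‖ ≤ C₀ := fun x => by
      have h0 := hC₀ t ht x
      rw [norm_iteratedFDeriv_zero] at h0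
      rw [norm_smul]
      rcases hε with h | h <;> simp [h, h0]
    obtain ⟨w, hw, hwK, hwc⟩ := planar_section_curl_apply_two hV hVK (y₁ 2)
    refine ⟨w, toLp 2 ![y₁ 0, y₁ 1], hw, hwK, fun x hx => ?_⟩
    have hmem := section_mem_ball hx
    have key := hm _ hmem
    rw [hwc x, curl_const_smul ((hU1 t ht).differentiable one_ne_zero _) ε]
    simpa [hζ] using key
  -- `ζ ≤ 0`
  have hle : ∀ t < 0, ∀ y, ζ t y ≤ 0 :=
    nonpos_of_lemma21_of_planarFlux h21 ham haA ⟨_, hζb⟩ hζ2 hfD hcD hcΔ heq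
      (fun t ht y₁ R m hm => hrep 1 (Or.inl rfl) t ht y₁ R m (fun y hy => by simpa using hm y hy))
  -- `−ζ ≤ 0`: the same for `−ζ` with the same drift
  set ζ' : ℝ → EuclideanSpace ℝ (Fin 3) → ℝ := fun t => -(ζ t) with hζ'
  have hζ'2 : ∀ t < 0, ContDiff ℝ 2 (ζ' t) := fun t ht => (hζ2 t ht).neg
  have hζ'b : ∃ C : ℝ, ∀ t < 0, ∀ y, |ζ' t y| ≤ C :=
    ⟨Kc * C₁, fun t ht y => by simpa [hζ', abs_neg] using hζb t ht y⟩
  have hζ'D : ∃ C : ℝ, ∀ t < 0, ∀ y, ‖fderiv ℝ (ζ' t) y‖ ≤ C ∧ |(Δ (ζ' t)) y| ≤ C := by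
    obtain ⟨C, hC⟩ := hfD
    refine ⟨C, fun t ht y => ?_⟩
    simp only [hζ', fderiv_neg, norm_neg, laplacian_neg, Pi.neg_apply, abs_neg]
    exact hC t ht y
  have hc'D : ContinuousOn (fun p : ℝ × EuclideanSpace ℝ (Fin 3) => fderiv ℝ (ζ' p.1) p.2) (Iio 0 ×ˢ univ) := by
    have : (fun p : ℝ × EuclideanSpace ℝ (Fin 3) => fderiv ℝ (ζ' p.1) p.2) = fun p => -fderiv ℝ (ζ p.1) p.2 := by
      funext p; simp [hζ', fderiv_neg]
    rw [this]
    exact hcD.neg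
  have hc'Δ : ContinuousOn (fun p : ℝ × EuclideanSpace ℝ (Fin 3) => (Δ (ζ' p.1)) p.2) (Iio 0 ×ˢ univ) := by
    have : (fun p : ℝ × EuclideanSpace ℝ (Fin 3) => (Δ (ζ' p.1)) p.2) = fun p => -(Δ (ζ p.1)) p.2 := by
      funext p; simp [hζ', laplacian_neg]
    rw [this]
    exact hcΔ.neg
  have heq' : ∀ y, ∀ s t : ℝ, s ≤ t → t < 0 →
      ζ' t y - ζ' s y = ∫ τ in s..t, ((Δ (ζ' τ)) y - fderiv ℝ (ζ' τ) y (a τ y)) := by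
    intro y s t hst ht
    have h := heq y s t hst ht
    have hpt : (fun τ => (Δ (ζ' τ)) y - fderiv ℝ (ζ' τ) y (a τ y)) =
        fun τ => -((Δ (ζ τ)) y - fderiv ℝ (ζ τ) y (a τ y)) := by
      funext τ
      have h1 : Δ (ζ' τ) = -(Δ (ζ τ)) := by rw [hζ']; exact laplacian_neg
      have h2 : fderiv ℝ (ζ' τ) y = -fderiv ℝ (ζ τ) y := by rw [hζ']; exact fderiv_neg
      rw [h1, h2]
      simp only [Pi.neg_apply, neg_apply]
      ring
    rw [hpt, intervalIntegral.integral_neg, ← h]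
    simp only [hζ', Pi.neg_apply]
    ring
  have hle' : ∀ t < 0, ∀ y, ζ' t y ≤ 0 :=
    nonpos_of_lemma21_of_planarFlux h21 ham haA hζ'b hζ'2 hζ'D hc'D hc'Δ heq'
      (fun t ht y₁ R m hm => hrep (-1) (Or.inr rfl) t ht y₁ R m
        (fun y hy => by simpa [hζ'] using hm y hy))
  -- conclude
  intro t ht x
  have h1 := hle t ht x
  have h2 := hle' t ht x
  simp only [hζ', Pi.neg_apply, neg_nonpos] at h2
  exact le_antisymm h1 h2

end Summit.NavierStokesRegularity.NavierStokesRegularity.Theorems.PoloidalWindowDoorPoloidalWindowRigidityErtelCollapseKNSS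

end
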